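/-
Copyright (c) 2026 the pub-hodgecm-mathlib formalisation cell (harness21).  Prover seat hodgecm-mathlib-K2E4-p10 (g4), Track B ∕ K2-LIT, h413 =
`stmt-HodgeConjecture-24833`, line `K2_E1_TraceFormulaBeta`, campaign «EIS-RANK-ONE» rung R6g («EIS-R6g» proper, brick (R6g-a) of the dealer K2E1-plan (g3)'s STANDING
ORDERS §F g3-v2, 2026-09-04T06:07:54Z ∕ 06:12Z): the sup-norm bound on `Λ^T E(φ, z)` of `U(2,1)` is LOCALLY UNIFORM in the spectral parameter `z`, modulo the z-uniform decay `hdec`.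
-/
import Summits.HodgeConjecture.HodgeConjecture.Theorems.K2E1TruncatedEisensteinBoundedCMThree   -- ★ p857707 (K2E4-p11 g3): `exists_isCompact_siegel_low_three`, CM binders; imports ★ R6e, ★ R4a, ★ reduction theory
import HarnessLib

/-!
# K2·E1 — `K2E1TruncatedEisensteinLocallyUniformCMThree`: `sup_g ‖Λ^T E(φ, z)(g)‖` IS BOUNDED LOCALLY UNIFORMLY IN `z` ON `{Re z > 2}` (modulo the z-uniform `hdec`)
# (campaign «EIS-RANK-ONE», rung R6g, brick (R6g-a): the `hΛbdd` input of ★ p857832 (B) ∕ of the dominated-convergence step (R6g-b), UNIFORM on compact sets of parameters)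

Track B ∕ K2-LIT, crux h413 = `stmt-HodgeConjecture-24833`, route of record `HCCMUnconditional`; cell `hodgecm-mathlib`, squad K2, ENGINE E1.  Prover seat
`hodgecm-mathlib-K2E4-p10` (g4); STANDING ORDERS §F g3-v2 of the dealer K2E1-plan (g3) (`TABLE.7th` l. 90), REPORT-FIRST 2026-09-04T06:20Z.  THEOREMS ONLY (no `def`, no `instance`,
no notation, no named-fact hypothesis, no `sorry`); lane `--supports stmt-HodgeConjecture-24833 --as helper` (count-neutral).  Closes no socket.

THE MATHEMATICS [MoeglinWaldspurger1995, I.2.13, IV.2; Arthur1980TraceFormulaII, §1 (Lemma 1.4), §4].  ★ R6e `norm_truncation_le_of_rational_invariant_three` bounds `‖Λ^T φ‖ ≤ max M₀ M₁`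
from reduction theory `hcov`, the low bound `hlow` on `𝔖 ∩ {H ≤ T}`, the decay `hdec` on `{H > T}` and left-`G(F)`-invariance, and ★ p857707 `exists_norm_truncation_le_three` discharged
`hcov` (★ `exists_siegel_cover_three`) and `hlow` (the low part of the Siegel set lies in ONE compact `C`, ★ `exists_isCompact_siegel_low_three`, + continuity).  For a FAMILY
`Φ : ι → G(𝔸) → ℂ` jointly continuous on `Z × G(𝔸)` with `Z` compact, the low bound is uniform on the compact `Z ×ˢ C` (`IsCompact.exists_bound_of_continuousOn`), so — §1
`exists_norm_truncation_le_family_three` — ONE `M₀` serves every `z ∈ Z`: `‖Λ^T Φ_z (g)‖ ≤ max M₀ M₁` for all `z ∈ Z`, all `g`, given the decay `hdec` with one `M₁` on `Z` (this is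
★ R6e `norm_truncation_le_of_cover_family` with its constants produced).  §2 at the CM pair `(L⁺, L, conj)` for `Φ_z = E(φ, z) = E(φ·H^z)`, `φ` continuous, bounded, left-`B(L⁺)`-invariant:
joint continuity in `(z, g)` on `{Re z > 2} × G(𝔸)` is ★ R4a `continuous_eisensteinSeriesU_flatSectionU_uncurry_cm_three`, `G(F)`-invariance ★ `eisensteinSeriesU_flatSectionU_arithmeticSubgroup_mul`,
Iwasawa ∕ `[L:L⁺] = 2` ∕ `c² = 1 ≠ c` ★; hence `exists_norm_truncation_eisensteinSeriesU_flatSectionU_le_uniform_cm_three` on every compact `Kc ⊂ {Re z > 2}` and its neighbourhood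
form `…_nhds_cm_three` (closed balls in the open half-plane are compact).  The ONE named input is the decay `hdec`, now z-UNIFORM on `Kc`:
`∀ z ∈ Kc, ∀ g, T < H g → ‖E(φ,z) g − E(φ,z)_B g‖ ≤ M₁` ((D2-e) ∘ ★ p857643 currency; for flat sections `E − E_B` on `{H > T}` is controlled by the R6d decay chain uniformly on strips).
HONEST LABEL: HC_CM is proved only modulo the 7 printed citations (2 remaining named inputs: hLiu418 = `stmt-HodgeConjecture-24832`, h413 = `stmt-HodgeConjecture-24833`) until rung 0
closes; this file asserts no named fact and closes no socket.
References: [MoeglinWaldspurger1995] I.2.13, IV.2 · [Arthur1980TraceFormulaII] §1 (Lemma 1.4), §4 · [Garrett2018] §2.10–§2.11.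
-/

set_option autoImplicit false
-- the mandated namespace repeats the single-problem summit's segment (`HodgeConjecture.HodgeConjecture`)
set_option linter.dupNamespace false

noncomputable section

open MeasureTheory Measure NumberField IsDedekindDomain Set Filter Topology MulAction
open scoped ENNReal NNReal Pointwise
open Literature.NumberTheory.Automorphic Literature.NumberTheory.Automorphic.UnitaryGroup AdelicGroupData
open Summit.HodgeConjecture.HodgeConjecture.Cruxes.H413.K2E1BorelEisensteinU
open Summit.HodgeConjecture.HodgeConjecture.Cruxes.H413.K2E1TruncatedEisensteinL2
open Summit.HodgeConjecture.HodgeConjecture.Cruxes.H413.K2E1ReductionTheoryU3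
open Summit.HodgeConjecture.HodgeConjecture.Cruxes.H413.K2E1BorelEisensteinRegularCMThree
open Summit.HodgeConjecture.HodgeConjecture.Cruxes.H413.K2E1TruncatedEisensteinBoundedCMThree

namespace Summit.HodgeConjecture.HodgeConjecture.Cruxes.H413.K2E1TruncatedEisensteinLocallyUniformCMThree

/-! ## §1 Generic quadratic `(F, E, c)`: a jointly continuous FAMILY over a compact parameter set has ONE low bound, hence ONE sup bound -/

section Family

variable {F E : Type} [Field F] [NumberField F] [Field E] [NumberField E] [Algebra F E] {c : E ≃ₐ[F] E}
variable [MeasurableSpace (adelicUnipotent F E c 3)] [BorelSpace (adelicUnipotent F E c 3)]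

/-- **`‖Λ^T Φ_z‖ ≤ max M₀ M₁` UNIFORMLY IN `z ∈ Z`, MODULO THE z-UNIFORM DECAY `hdec`** (`U(J₃)`, `[E:F] = 2`, `c² = 1 ≠ c`, Iwasawa `hIw`; `T ≥ 1`; `Z` a compact set of parameters,
`(z, g) ↦ Φ_z(g)` continuous on `Z × G(𝔸)`, each `Φ_z` left-`G(F)`-invariant): ★ `exists_siegel_cover_three` and ★ `exists_isCompact_siegel_low_three` give a Siegel set `𝔖` with
`G(F)·𝔖 = G(𝔸)` whose low part `𝔖 ∩ {H ≤ T}` lies in a compact `C`; `Φ` is bounded by one `M₀` on the compact `Z ×ˢ C`; ★ R6e `norm_truncation_le_of_rational_invariant_three` per `z`.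
[cite: MoeglinWaldspurger1995, I.2.13 and IV.2] [cite: Arthur1980TraceFormulaII, §1 (Lemma 1.4)] [cite: Garrett2018, §2.10–§2.11] -/
theorem exists_norm_truncation_le_family_three (h2 : Module.finrank F E = 2) (hc : c * c = 1) (hc1 : c ≠ 1)
    (hIw : ∀ g : (quasiSplit F E c 3).Adelic, ∃ b ∈ borelAdelic F E c 3, ∃ k : (quasiSplit F E c 3).Adelic,
      adelicVal F E c 3 ((StdForm.antidiagonal 3).over E) k ∈ standardMaximalCompactGL 3 E ∧ g = b * k)
    (ν : Measure (adelicUnipotent F E c 3)) [ν.IsHaarMeasure] {𝓕 : Set (adelicUnipotent F E c 3)}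
    (h𝓕 : IsFundamentalDomain (rationalUnipotent F E c 3) 𝓕 ν) {T : ℝ≥0} (hT : 1 ≤ T)
    {ι : Type*} [TopologicalSpace ι] {Z : Set ι} (hZ : IsCompact Z) {Φ : ι → (quasiSplit F E c 3).Adelic → ℂ}
    (hΦc : ContinuousOn (fun p : ι × (quasiSplit F E c 3).Adelic => Φ p.1 p.2) (Z ×ˢ univ))
    (hΦ : ∀ z ∈ Z, ∀ (γ : (quasiSplit F E c 3).arithmeticSubgroup) (x : (quasiSplit F E c 3).Adelic), Φ z ((γ : (quasiSplit F E c 3).Adelic) * x) = Φ z x)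
    {M₁ : ℝ} (hdec : ∀ z ∈ Z, ∀ g : (quasiSplit F E c 3).Adelic, T < borelHeight g → ‖Φ z g - borelConstantTerm ν 𝓕 (Φ z) g‖ ≤ M₁) :
    ∃ M₀ : ℝ, ∀ z ∈ Z, ∀ g : (quasiSplit F E c 3).Adelic, ‖truncation ν 𝓕 T (Φ z) g‖ ≤ max M₀ M₁ := by
  haveI := t2Space_adeleRing_of_numberField E
  haveI : T2Space (quasiSplit F E c 3).Adelic := inferInstanceAs (T2Space (adelic F E c 3 ((StdForm.antidiagonal 3).over E)))
  obtain ⟨Ω, K, t, ht, hΩ, hΩc, hKc, hcov⟩ := exists_siegel_cover_three h2 hc1 hc hIw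
  obtain ⟨C, hC, hsub⟩ := exists_isCompact_siegel_low_three hIw ht hΩ (by rw [hΩc.isClosed.closure_eq]; exact hΩc) hKc T
  -- ONE low bound on the compact `Z ×ˢ C`
  obtain ⟨M₀, hM₀⟩ := (hZ.prod hC).exists_bound_of_continuousOn (hΦc.mono (prod_mono le_rfl (subset_univ C)))
  refine ⟨M₀, fun z hz g => ?_⟩
  exact norm_truncation_le_of_rational_invariant_three ν h𝓕 hT (hΦ z hz) hcov (fun s hs hsT => hM₀ (z, s) (mk_mem_prod hz (hsub s hs hsT))) (hdec z hz) g

/-- The same bound packaged as ★ R6e `norm_truncation_le_of_cover_family`'s conclusion with BOTH constants produced: `∃ M, ∀ z ∈ Z, ∀ g, ‖Λ^T Φ_z (g)‖ ≤ M`.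
[cite: MoeglinWaldspurger1995, IV.2] -/
theorem exists_forall_norm_truncation_le_family_three (h2 : Module.finrank F E = 2) (hc : c * c = 1) (hc1 : c ≠ 1)
    (hIw : ∀ g : (quasiSplit F E c 3).Adelic, ∃ b ∈ borelAdelic F E c 3, ∃ k : (quasiSplit F E c 3).Adelic,
      adelicVal F E c 3 ((StdForm.antidiagonal 3).over E) k ∈ standardMaximalCompactGL 3 E ∧ g = b * k)
    (ν : Measure (adelicUnipotent F E c 3)) [ν.IsHaarMeasure] {𝓕 : Set (adelicUnipotent F E c 3)}
    (h𝓕 : IsFundamentalDomain (rationalUnipotent F E c 3) 𝓕 ν) {T : ℝ≥0} (hT : 1 ≤ T)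
    {ι : Type*} [TopologicalSpace ι] {Z : Set ι} (hZ : IsCompact Z) {Φ : ι → (quasiSplit F E c 3).Adelic → ℂ}
    (hΦc : ContinuousOn (fun p : ι × (quasiSplit F E c 3).Adelic => Φ p.1 p.2) (Z ×ˢ univ))
    (hΦ : ∀ z ∈ Z, ∀ (γ : (quasiSplit F E c 3).arithmeticSubgroup) (x : (quasiSplit F E c 3).Adelic), Φ z ((γ : (quasiSplit F E c 3).Adelic) * x) = Φ z x)
    {M₁ : ℝ} (hdec : ∀ z ∈ Z, ∀ g : (quasiSplit F E c 3).Adelic, T < borelHeight g → ‖Φ z g - borelConstantTerm ν 𝓕 (Φ z) g‖ ≤ M₁) :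
    ∃ M : ℝ, ∀ z ∈ Z, ∀ g : (quasiSplit F E c 3).Adelic, ‖truncation ν 𝓕 T (Φ z) g‖ ≤ M := by
  obtain ⟨M₀, hM₀⟩ := exists_norm_truncation_le_family_three h2 hc hc1 hIw ν h𝓕 hT hZ hΦc hΦ hdec
  exact ⟨max M₀ M₁, hM₀⟩

end Family

/-! ## §2 The CM pair `(L⁺, L, conj)`: `Φ_z = E(φ, z)`, uniformly on compact `Kc ⊂ {Re z > 2}` and on neighbourhoods -/

section CM

variable (L : Type) [Field L] [NumberField L] [IsCMField L]
variable [MeasurableSpace (adelicUnipotent (↥(maximalRealSubfield L)) L (IsCMField.complexConj L) 3)]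
  [BorelSpace (adelicUnipotent (↥(maximalRealSubfield L)) L (IsCMField.complexConj L) 3)]

/-- **`sup_g ‖Λ^T E(φ, z)(g)‖ ≤ max M₀ M₁` UNIFORMLY FOR `z` IN A COMPACT `Kc ⊂ {Re z > 2}`, MODULO THE z-UNIFORM `hdec`** — the CM pair `(L⁺, L, conj)`, `T ≥ 1`, `φ` continuous,
bounded and left-`B(L⁺)`-invariant, `ν` Haar on `N(𝔸)`, `𝓕` a fundamental domain of `N(L⁺)`: §1 at `ι := {z // 2 < Re z}`, `Z := val⁻¹ Kc` (compact), the joint continuity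
★ R4a `continuous_eisensteinSeriesU_flatSectionU_uncurry_cm_three`, `G(F)`-invariance ★ `eisensteinSeriesU_flatSectionU_arithmeticSubgroup_mul`, Iwasawa ★, `[L:L⁺] = 2`, `c² = 1 ≠ c` ★.
[cite: MoeglinWaldspurger1995, I.2.13 and IV.2] [cite: Arthur1980TraceFormulaII, §1 (Lemma 1.4) and §4] -/
theorem exists_norm_truncation_eisensteinSeriesU_flatSectionU_le_uniform_cm_three
    (ν : Measure (adelicUnipotent (↥(maximalRealSubfield L)) L (IsCMField.complexConj L) 3)) [ν.IsHaarMeasure]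
    {𝓕 : Set (adelicUnipotent (↥(maximalRealSubfield L)) L (IsCMField.complexConj L) 3)}
    (h𝓕 : IsFundamentalDomain (rationalUnipotent (↥(maximalRealSubfield L)) L (IsCMField.complexConj L) 3) 𝓕 ν) {T : ℝ≥0} (hT : 1 ≤ T)
    {Kc : Set ℂ} (hKc : IsCompact Kc) (hKc2 : ∀ z ∈ Kc, 2 < z.re)
    {φ : (quasiSplit (↥(maximalRealSubfield L)) L (IsCMField.complexConj L) 3).Adelic → ℂ} (hφc : Continuous φ) {M : ℝ} (hφM : ∀ x, ‖φ x‖ ≤ M)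
    (hφB : ∀ b ∈ borelU ((IsCMField.complexConj L : L ≃ₐ[↥(maximalRealSubfield L)] L) : L →+* L) ((StdForm.antidiagonal 3).over L),
      ∀ x : (quasiSplit (↥(maximalRealSubfield L)) L (IsCMField.complexConj L) 3).Adelic,
        φ ((quasiSplit (↥(maximalRealSubfield L)) L (IsCMField.complexConj L) 3).toAdelic b * x) = φ x)
    {M₁ : ℝ} (hdec : ∀ z ∈ Kc, ∀ g : (quasiSplit (↥(maximalRealSubfield L)) L (IsCMField.complexConj L) 3).Adelic, T < borelHeight g →
      ‖eisensteinSeriesU (flatSectionU φ z) g - borelConstantTerm ν 𝓕 (eisensteinSeriesU (flatSectionU φ z)) g‖ ≤ M₁) :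
    ∃ M₀ : ℝ, ∀ z ∈ Kc, ∀ g : (quasiSplit (↥(maximalRealSubfield L)) L (IsCMField.complexConj L) 3).Adelic,
      ‖truncation ν 𝓕 T (eisensteinSeriesU (flatSectionU φ z)) g‖ ≤ max M₀ M₁ := by
  -- the parameter space `ι := {z // 2 < Re z}` and the compact `Z := val⁻¹ Kc`
  have hZ : IsCompact (((↑) : {z : ℂ // 2 < z.re} → ℂ) ⁻¹' Kc) := by
    have hsub : Kc ∩ {x : ℂ | 2 < x.re} = Kc := inter_eq_left.2 fun z hz => hKc2 z hz
    rw [Subtype.isCompact_iff, image_preimage_eq_inter_range, Subtype.range_coe_subtype, hsub]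
    exact hKc
  have hcont := continuous_eisensteinSeriesU_flatSectionU_uncurry_cm_three L hφc hφM
  obtain ⟨M₀, hM₀⟩ := exists_norm_truncation_le_family_three (Algebra.IsQuadraticExtension.finrank_eq_two (↥(maximalRealSubfield L)) L)
    (AlgEquiv.ext fun x => IsCMField.complexConj_apply_apply L x) (IsCMField.complexConj_ne_one L) (exists_mem_borelAdelic_mul_mem_standardMaximalCompactGL_cm_three L)
    ν h𝓕 hT hZ (Φ := fun (w : {z : ℂ // 2 < z.re}) g => eisensteinSeriesU (flatSectionU φ (w : ℂ)) g) hcont.continuousOn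
    (fun w _ γ x => eisensteinSeriesU_flatSectionU_arithmeticSubgroup_mul hφB (w : ℂ) γ x) (M₁ := M₁) (fun w hw g hg => hdec (w : ℂ) hw g hg)
  exact ⟨M₀, fun z hz g => hM₀ ⟨z, hKc2 z hz⟩ hz g⟩

/-- **Neighbourhood form**: every `z₀` with `Re z₀ > 2` has a neighbourhood `V ⊂ {Re z > 2}` (a closed ball) on which, modulo the z-uniform `hdec` on `V`, ONE bound
`sup_g ‖Λ^T E(φ, z)(g)‖ ≤ max M₀ M₁` holds for all `z ∈ V` — the `hΛbdd` input of the dominated-convergence step (R6g-b) at `z₀`. [cite: MoeglinWaldspurger1995, IV.2] [cite: Arthur1980TraceFormulaII, §4] -/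
theorem exists_nhds_norm_truncation_eisensteinSeriesU_flatSectionU_le_cm_three
    (ν : Measure (adelicUnipotent (↥(maximalRealSubfield L)) L (IsCMField.complexConj L) 3)) [ν.IsHaarMeasure]
    {𝓕 : Set (adelicUnipotent (↥(maximalRealSubfield L)) L (IsCMField.complexConj L) 3)}
    (h𝓕 : IsFundamentalDomain (rationalUnipotent (↥(maximalRealSubfield L)) L (IsCMField.complexConj L) 3) 𝓕 ν) {T : ℝ≥0} (hT : 1 ≤ T)
    {z₀ : ℂ} (hz₀ : 2 < z₀.re)
    {φ : (quasiSplit (↥(maximalRealSubfield L)) L (IsCMField.complexConj L) 3).Adelic → ℂ} (hφc : Continuous φ) {M : ℝ} (hφM : ∀ x, ‖φ x‖ ≤ M)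
    (hφB : ∀ b ∈ borelU ((IsCMField.complexConj L : L ≃ₐ[↥(maximalRealSubfield L)] L) : L →+* L) ((StdForm.antidiagonal 3).over L),
      ∀ x : (quasiSplit (↥(maximalRealSubfield L)) L (IsCMField.complexConj L) 3).Adelic,
        φ ((quasiSplit (↥(maximalRealSubfield L)) L (IsCMField.complexConj L) 3).toAdelic b * x) = φ x) :
    ∃ V ∈ 𝓝 z₀, IsCompact V ∧ (∀ z ∈ V, 2 < z.re) ∧
      ∀ {M₁ : ℝ}, (∀ z ∈ V, ∀ g : (quasiSplit (↥(maximalRealSubfield L)) L (IsCMField.complexConj L) 3).Adelic, T < borelHeight g →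
          ‖eisensteinSeriesU (flatSectionU φ z) g - borelConstantTerm ν 𝓕 (eisensteinSeriesU (flatSectionU φ z)) g‖ ≤ M₁) →
        ∃ M₀ : ℝ, ∀ z ∈ V, ∀ g : (quasiSplit (↥(maximalRealSubfield L)) L (IsCMField.complexConj L) 3).Adelic,
          ‖truncation ν 𝓕 T (eisensteinSeriesU (flatSectionU φ z)) g‖ ≤ max M₀ M₁ := by
  -- the closed ball of radius `(Re z₀ − 2)/2` around `z₀` lies in the half-plane
  set r : ℝ := (z₀.re - 2) / 2 with hr
  have hr0 : 0 < r := by rw [hr]; linarith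
  have hball : ∀ z ∈ Metric.closedBall z₀ r, 2 < z.re := by
    intro z hz
    have hdist : dist z z₀ ≤ r := Metric.mem_closedBall.1 hz
    have hre : |z.re - z₀.re| ≤ r := by
      have h1 := Complex.abs_re_le_norm (z - z₀)
      rw [Complex.sub_re, ← Complex.dist_eq] at h1
      exact h1.trans hdist
    have := (abs_le.1 hre).1
    rw [hr] at this
    linarith
  refine ⟨Metric.closedBall z₀ r, Metric.closedBall_mem_nhds z₀ hr0, isCompact_closedBall z₀ r, hball, fun {M₁} hdec => ?_⟩
  exact exists_norm_truncation_eisensteinSeriesU_flatSectionU_le_uniform_cm_three L ν h𝓕 hT (isCompact_closedBall z₀ r) hball hφc hφM hφB hdec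

end CM

end Summit.HodgeConjecture.HodgeConjecture.Cruxes.H413.K2E1TruncatedEisensteinLocallyUniformCMThree

end
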